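import Summits.BirchSwinnertonDyer.BirchSwinnertonDyer.Theorems.AdditiveBranchIMCGordTwoRankZeroOffCaseOneFieldSupplyTwoR0Aux
import HarnessLib

/-!
# Route `AdditiveBranchIMC`, crux `GordTwoRankZeroOffCaseOne` (stmt-BirchSwinnertonDyer-19357): (F2₂) the genus-class FIELD TWO over a road field in
# which `2` RAMIFIES — part 2/3: §4 the `p`-ramified Kolyvagin class and its rank-zero good-ordinary partner `A`

Theorems-side landing (prover bsd-addord-stub-2 g0, `--supports stmt-BirchSwinnertonDyer-19357`, helper only) of the pen's checked crux workfile
`Cruxes/GordTwoRankZeroOffCaseOne/WanAnyFieldTwoR0Landing.lean` (bsd-addord-plan gen 44, commit 7fa9383eae77; = `WanAnyFieldTwoR0.lean` v2 b8469de9518d),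
declarations and proofs VERBATIM, split MECHANICALLY along its sections (part 1 = `…FieldSupplyTwoR0Aux` §1–§3; part 3 = `…FieldSupplyTwoR0` §5).
This part: §4 `exists_ramifiedClass_partner_two` (`d_{K''} = p*·e₂·ℓ₀*·d` an EVEN fundamental discriminant, `2` ramified in `K''`, `u = p*Td ≡ 1 (mod 8)`).
0 sorries. BSD is proved for no curve by any of this.
[cite: FriedbergHoffstein1995, Theorem B] [cite: SilvermanAEC2009, X.5 Cor. 5.4 and App. C §16] [cite: Cox2013, §1.C Lemma 1.14 and (2.6)]
-/

set_option linter.dupNamespace false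

noncomputable section

open scoped Classical

open WeierstrassCurve NumberField IsDedekindDomain Rat.HeightOneSpectrum
  Literature.NumberTheory.EllipticCurves
  Literature.NumberTheory.EllipticCurves.ModularForms
  Literature.NumberTheory.EllipticCurves.Rank1Residual
  Literature.NumberTheory.QuadraticFields
  Summit.BirchSwinnertonDyer.Rank1Residual
  Summit.BirchSwinnertonDyer.Rank1Residual.Additive

namespace Summit.BirchSwinnertonDyer.BirchSwinnertonDyer.Theorems.WanAnyRoad

open NumberTheorySymbols ZMod
open Summit.BirchSwinnertonDyer.BirchSwinnertonDyer.Theorems.ThreeFieldRoadSupply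
open Summit.BirchSwinnertonDyer.BirchSwinnertonDyer.Theorems.AdditiveKoly.RamifiedHabitat (pStar_emod_four eq_of_prime_dvd_pStar)
open Literature.NumberTheory.EllipticCurves.Castella2018.TamagawaQuadratic

/-! ### §4 The `p`-ramified Kolyvagin class at the Wan prime `2` (E356 (d)) -/

section ClassTwo

variable (W : WeierstrassCurve ℚ) [W.IsElliptic] [W.IsGloballyMinimal] (p : ℕ) [hp : Fact p.Prime]
  (K : Type) [Field K] [NumberField K] {Wd : WeierstrassCurve ℚ} [Wd.IsElliptic]

set_option maxHeartbeats 800000 in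
/-- **FIELD 2 at the Wan prime `2`, step 2 — the `p`-ramified Kolyvagin class and its rank-zero good-ordinary partner `A`**
(the `q = 2` port of `exists_ramifiedClass_partner`): `d_{K''} = p*·e₂·ℓ₀*·d` is an EVEN fundamental discriminant (`2` ramified in
`K''`), every prime `ℓ ∉ {2, p}` of `N_E N_{Wd}` splits in `K''`, the common primes of `d_{K''}` and `N_E N_{Wd}` are `p, 2`, the free
prime is `ℓ₀`, and `u = p*Td` is `≡ 1 (mod 8)` and a square at every odd bad prime `≠ p` of `E`.
[cite: FriedbergHoffstein1995, Thm. B (1), as applied in JetchevSkinnerWan2017 §7.4.1] [cite: SilvermanAEC2009, X.5 Cor. 5.4 and App. C §16]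
[cite: Cox2013, §1.C Lemma 1.14 and (2.6)] -/
theorem exists_ramifiedClass_partner_two
    (hFH : friedbergHoffstein_exists_heegnerField_splitDivisors_twist_ne_zero)
    (hmod : exists_isNewformOf) (hL : hasEntireLFunction_rat)
    (hp5 : 5 ≤ p) (hw : W.rootNumber = 1) (hcell : N10.CellGordTwo W p) (hsurj : Surj W p)
    (hK : IsImaginaryQuadratic K) (h2d : (2 : ℤ) ∣ NumberField.discr K)
    (hsplit : ∀ ℓ : ℕ, ℓ.Prime → ℓ ∣ W.conductorNorm ℤ → ℓ ≠ 2 →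
      ((Ideal.span {(ℓ : ℤ)}).primesOver (𝓞 K)).ncard = 2)
    (Cd : VariableChange ℚ) (hWd : Cd • W.quadraticTwist (NumberField.discr K : ℚ) = Wd) :
    ∃ (ℓ₀ : ℕ) (e₂ T d : ℤ) (K'' : Type) (_ : Field K'') (_ : NumberField K'')
      (A : WeierstrassCurve ℚ) (_ : A.IsElliptic) (_ : A.IsGloballyMinimal),
      ℓ₀.Prime ∧ ℓ₀ ≠ p ∧ ℓ₀ ≠ 2 ∧ ¬ ℓ₀ ∣ Wd.conductorNorm ℤ ∧
      (e₂ = -4 ∨ e₂ = 8 ∨ e₂ = -8) ∧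
      NumberField.discr K'' =
        ((-1 : ℤ) ^ (p / 2) * p) * e₂ * ((-1 : ℤ) ^ (ℓ₀ / 2) * ℓ₀) * d ∧
      IsImaginaryQuadratic K'' ∧
      (∀ ℓ : ℕ, ℓ.Prime → ℓ ∣ W.conductorNorm ℤ * Wd.conductorNorm ℤ → ℓ ≠ p → ℓ ≠ 2 →
        SatisfiesHeegnerHypothesis ℓ K'') ∧
      (∀ ℓ : ℕ, ℓ.Prime → (ℓ : ℤ) ∣ NumberField.discr K'' →
        ℓ ∣ W.conductorNorm ℤ * Wd.conductorNorm ℤ → ℓ = p ∨ ℓ = 2) ∧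
      (∃ C : VariableChange ℚ, C • Wd.quadraticTwist (NumberField.discr K'' : ℚ) = A) ∧
      (∃ C : VariableChange ℚ, C • W.quadraticTwist ((((-1 : ℤ) ^ (p / 2) * p) * T * d : ℤ) : ℚ) = A) ∧
      (((-1 : ℤ) ^ (p / 2) * p) * T * d) % 4 = 1 ∧ Squarefree (((-1 : ℤ) ^ (p / 2) * p) * T * d) ∧
      (∀ ℓ : ℕ, ℓ.Prime → ℓ ∣ W.conductorNorm ℤ → ℓ ≠ p →
        (ℓ = 2 → (((-1 : ℤ) ^ (p / 2) * p) * T * d) % 8 = 1) ∧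
        (ℓ ≠ 2 → J(((-1 : ℤ) ^ (p / 2) * p) * T * d | ℓ) = 1)) ∧
      A.analyticRank = 0 ∧ GoodOrd A p ∧ Surj A p := by
  have hp2 : p ≠ 2 := by omega
  obtain ⟨V, iV, iVm, C', e₂, δ, ℓ₀, X, iX, iXm, CX, hC', hordV, hNWV, he₂, hfac, -, hδsq, -, hpδ, hδ0, hℓ₀,
      hℓ₀p, hℓ₀2, hℓ₀M, hℓ₀δ, -, h8ℓ₀, hJsplit, hT4, hneg, hb, h8, hCX, hXroot⟩ :=
    exists_auxTwist_two W p K hmod hp5 hw hcell hK h2d hsplit (Wd.conductorNorm ℤ)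
      (Wd.conductorNorm_pos_holds).ne'
  have he₂0' : e₂ ≠ 0 := by rcases he₂ with h | h | h <;> rw [h] <;> norm_num
  have he₂8 : e₂ ∣ 8 := by rcases he₂ with h | h | h <;> rw [h] <;> norm_num
  -- notation
  set ps : ℤ := (-1 : ℤ) ^ (p / 2) * p with hps
  set ls : ℤ := (-1 : ℤ) ^ (ℓ₀ / 2) * ℓ₀ with hls
  set T : ℤ := δ * ls with hT
  set dK : ℤ := NumberField.discr K with hdK
  clear_value dK
  have hdK0 : dK ≠ 0 := by rw [hdK]; exact NumberField.discr_ne_zero K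
  have hdKneg : dK < 0 := by rw [hdK]; exact hK.discr_neg
  have hNW0 : W.conductorNorm ℤ ≠ 0 := (W.conductorNorm_pos_holds).ne'
  have hNWd0 : Wd.conductorNorm ℤ ≠ 0 := (Wd.conductorNorm_pos_holds).ne'
  set M : ℕ := W.conductorNorm ℤ * Wd.conductorNorm ℤ with hM
  have hM0 : M ≠ 0 := mul_ne_zero hNW0 hNWd0
  have hℓ₀NW : ¬ ℓ₀ ∣ W.conductorNorm ℤ := fun h ↦ hℓ₀M (h.mul_right _)
  have hℓ₀NWd : ¬ ℓ₀ ∣ Wd.conductorNorm ℤ := fun h ↦ hℓ₀M (h.mul_left _)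
  have hls4 : ls % 4 = 1 := (haveI := Fact.mk hℓ₀; pStar_emod_four (p := ℓ₀) hℓ₀2)
  have hps4 : ps % 4 = 1 := pStar_emod_four (p := p) hp2
  have hT0 : T ≠ 0 := by rintro h; rw [h] at hT4; norm_num at hT4
  have hTq : (T : ℚ) ≠ 0 := by exact_mod_cast hT0
  haveI := V.isElliptic_quadraticTwist hTq
  -- §e Friedberg–Hoffstein on `X`
  set SFH : Finset ℕ := (2 * p * ℓ₀ * M * dK.natAbs).primeFactors with hSFH
  have hSFH0 : 2 * p * ℓ₀ * M * dK.natAbs ≠ 0 := by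
    refine mul_ne_zero (mul_ne_zero (mul_ne_zero (mul_ne_zero two_ne_zero
      hp.out.ne_zero) hℓ₀.ne_zero) hM0) (Int.natAbs_ne_zero.mpr hdK0)
  have hSFH_mem : ∀ ℓ : ℕ, ℓ.Prime → ℓ ∣ 2 * p * ℓ₀ * M * dK.natAbs → ℓ ∈ SFH := fun ℓ hℓ hd ↦
    Nat.mem_primeFactors.mpr ⟨hℓ, hd, hSFH0⟩
  obtain ⟨d, hdneg, hdsq, hd8, -, hdS, hdX, hLd⟩ :=
    exists_neg_fundamental_twist_ne_zero_of_friedbergHoffstein hFH X hXroot SFH 0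
  have hd0 : d ≠ 0 := hdneg.ne
  have hdq0 : (d : ℚ) ≠ 0 := by exact_mod_cast hd0
  have hd4 : d % 4 = 1 := by omega
  -- `(d/ℓ) = 1`, hence `ℓ ∤ d`, for every odd prime of `2 p ℓ₀ M d_K`
  have hdJ : ∀ ℓ : ℕ, ℓ.Prime → ℓ ∣ 2 * p * ℓ₀ * M * dK.natAbs → ℓ ≠ 2 → J(d | ℓ) = 1 :=
    fun ℓ hℓ hd h2 ↦ hdS ℓ (hSFH_mem ℓ hℓ hd) hℓ h2
  have hd_ndvd : ∀ ℓ : ℕ, ℓ.Prime → ℓ ∣ 2 * p * ℓ₀ * M * dK.natAbs → ¬ (ℓ : ℤ) ∣ d := by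
    intro ℓ hℓ hd
    by_cases h2 : ℓ = 2
    · subst h2; intro h; omega
    · exact not_dvd_of_jacobiSym_eq_one hℓ (hdJ ℓ hℓ hd h2)
  have hpd : ¬ (p : ℤ) ∣ d := hd_ndvd p hp.out ⟨2 * ℓ₀ * M * dK.natAbs, by ring⟩
  have hℓ₀d : ¬ (ℓ₀ : ℤ) ∣ d := hd_ndvd ℓ₀ hℓ₀ ⟨2 * p * M * dK.natAbs, by ring⟩
  -- §f the partner `A`, a globally minimal model of `X^{(d)}`
  haveI := X.isElliptic_quadraticTwist hdq0
  obtain ⟨A, iA, iAm, CA, hCA⟩ := exists_isGloballyMinimal_smul_eq_quadraticTwist X hdq0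
  have hrA : A.analyticRank = 0 := by
    rw [← analyticRank_smul A CA, hCA]
    exact ((X.quadraticTwist (d : ℚ)).analyticRank_eq_zero_iff_holds (hL _)).2 hLd
  -- §g the twist relations
  have hps0' : ps ≠ 0 := by
    rw [hps]; exact mul_ne_zero (pow_ne_zero _ (by norm_num)) (by exact_mod_cast hp.out.ne_zero)
  set u : ℤ := ps * T * d with hu
  have hAV : ∃ C : VariableChange ℚ, C • A = V.quadraticTwist ((T * d : ℤ) : ℚ) := by
    obtain ⟨C₃, hC₃⟩ : ∃ C₃ : VariableChange ℚ, C₃ = ⟨CX⁻¹.u, (d : ℚ) * CX⁻¹.r, 0, 0⟩ := ⟨_, rfl⟩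
    have hX : X = CX⁻¹ • V.quadraticTwist (T : ℚ) := by rw [← hCX, inv_smul_smul]
    have hparam : ((T : ℚ)) * (d : ℚ) = ((T * d : ℤ) : ℚ) := by push_cast; ring
    have e1 : X.quadraticTwist (d : ℚ) = C₃ • V.quadraticTwist ((T * d : ℤ) : ℚ) := by
      rw [hX, WeierstrassCurve.quadraticTwist_smul, quadraticTwist_quadraticTwist, ← hC₃, hparam]
    refine ⟨C₃⁻¹ * CA, ?_⟩
    rw [mul_smul, hCA, e1, inv_smul_smul]
  have hAW : ∃ C : VariableChange ℚ, C • W.quadraticTwist ((u : ℤ) : ℚ) = A := by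
    obtain ⟨C₁, hC₁⟩ := hAV
    -- `W^{(u)} ≅ V^{(ps u)} = V^{(T d ps²)} ≅ V^{(T d)} ≅ A`
    obtain ⟨C'', hC''⟩ : ∃ C'' : VariableChange ℚ, C'' = ⟨C'.u, ((u : ℤ) : ℚ) * C'.r, 0, 0⟩ :=
      ⟨_, rfl⟩
    have hparam : ((-1 : ℚ) ^ (p / 2) * (p : ℚ)) * ((u : ℤ) : ℚ) =
        ((T * d : ℤ) : ℚ) * ((ps : ℤ) : ℚ) ^ 2 := by
      rw [hu, hps]; push_cast; ring
    have e1 : W.quadraticTwist ((u : ℤ) : ℚ) =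
        C'' • V.quadraticTwist (((T * d : ℤ) : ℚ) * ((ps : ℤ) : ℚ) ^ 2) := by
      rw [← hC', WeierstrassCurve.quadraticTwist_smul, quadraticTwist_quadraticTwist, ← hC'', hparam]
    have hps0 : ((ps : ℤ) : ℚ) ≠ 0 := by exact_mod_cast hps0'
    obtain ⟨C₂, hC₂⟩ := V.exists_variableChange_quadraticTwist_mul_sq (((T * d : ℤ) : ℚ)) _ hps0
    have e2 : W.quadraticTwist ((u : ℤ) : ℚ) = (C'' * C₂ * C₁) • A := by
      rw [e1, ← hC₂, ← hC₁, mul_smul, mul_smul]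
    exact ⟨(C'' * C₂ * C₁)⁻¹, by rw [e2, inv_smul_smul]⟩
  -- §h the discriminant `d'' = p* e₂ ℓ₀* d` (an EVEN fundamental discriminant) and the field `K''`
  set D : ℤ := ps * e₂ * ls * d with hD
  have hpse₂ls_pos : 0 < ps * e₂ * ls := by
    -- `(ps e₂ ls) δ² = (ps δ ls)(e₂ δ) = (ps T)(d_K) > 0`
    have he₂δ : e₂ * δ < 0 := by rw [← hfac]; exact hdKneg
    have h1' : 0 < (ps * T) * (e₂ * δ) := mul_pos_of_neg_of_neg hneg he₂δ
    have e : (ps * T) * (e₂ * δ) = (ps * e₂ * ls) * (δ * δ) := by rw [hT]; ring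
    rw [e] at h1'
    have hδ2 : 0 < δ * δ := mul_self_pos.mpr hδ0
    exact (pos_iff_pos_of_mul_pos h1').mpr hδ2
  have hDneg : D < 0 := by rw [hD]; exact mul_neg_of_pos_of_neg hpse₂ls_pos hdneg
  -- `D / 4 = (e₂ / 4) · m` with `m = p* ℓ₀* d ≡ 1 (mod 4)` odd and square-free
  set m : ℤ := ps * ls * d with hm
  have hm4 : m % 4 = 1 := by
    rw [hm, Int.mul_emod, show (ps * ls) % 4 = 1 by rw [Int.mul_emod, hps4, hls4]; decide, hd4]; decide
  have hm2 : ¬ (2 : ℤ) ∣ m := by intro h; omega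
  have hmsq : Squarefree m := by
    -- `|m| = p ℓ₀ |d|` with `p, ℓ₀` distinct primes not dividing the square-free `d`
    rw [← Int.squarefree_natAbs]
    have hmabs : m.natAbs = p * ℓ₀ * d.natAbs := by
      rw [hm, Int.natAbs_mul, Int.natAbs_mul, hps, hls, natAbs_pStar, natAbs_pStar (p := ℓ₀)]
    rw [hmabs]
    have hcop1 : Nat.Coprime (p * ℓ₀) d.natAbs := by
      refine Nat.Coprime.mul_left ?_ ?_
      · exact (Nat.Prime.coprime_iff_not_dvd hp.out).mpr fun h ↦
          hpd (Int.natAbs_dvd_natAbs.mp (by simpa using h))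
      · exact (Nat.Prime.coprime_iff_not_dvd hℓ₀).mpr fun h ↦
          hℓ₀d (Int.natAbs_dvd_natAbs.mp (by simpa using h))
    rw [Nat.squarefree_mul hcop1]
    refine ⟨?_, Int.squarefree_natAbs.mpr hdsq⟩
    rw [Nat.squarefree_mul ((Nat.coprime_primes hp.out hℓ₀).mpr (Ne.symm hℓ₀p))]
    exact ⟨hp.out.prime.squarefree, hℓ₀.prime.squarefree⟩
  have h2msq : Squarefree (2 * m) := by
    rw [squarefree_mul_iff]
    refine ⟨?_, Int.prime_two.squarefree, hmsq⟩
    refine (Int.isCoprime_iff_gcd_eq_one.mpr ?_).isRelPrime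
    rw [Int.gcd_eq_natAbs]
    exact (Nat.Prime.coprime_iff_not_dvd Nat.prime_two).mpr fun h ↦
      hm2 (Int.natAbs_dvd_natAbs.mp (by simpa using h))
  have hsq_neg : ∀ x : ℤ, Squarefree x → Squarefree (-x) := fun x hx ↦ by
    rw [← Int.squarefree_natAbs, Int.natAbs_neg, Int.squarefree_natAbs]; exact hx
  have hDfund : 4 ∣ D ∧ (D / 4 % 4 = 2 ∨ D / 4 % 4 = 3) ∧ Squarefree (D / 4) := by
    rcases he₂ with h | h | h
    · have hD' : D = 4 * (-m) := by rw [hD, hm, h]; ring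
      have hq4 : D / 4 = -m := by rw [hD']; exact Int.mul_ediv_cancel_left _ (by norm_num)
      refine ⟨⟨-m, hD'⟩, ?_, ?_⟩
      · rw [hq4]; right; omega
      · rw [hq4]; exact hsq_neg m hmsq
    · have hD' : D = 4 * (2 * m) := by rw [hD, hm, h]; ring
      have hq4 : D / 4 = 2 * m := by rw [hD']; exact Int.mul_ediv_cancel_left _ (by norm_num)
      refine ⟨⟨2 * m, hD'⟩, ?_, ?_⟩
      · rw [hq4]; left; omega
      · rw [hq4]; exact h2msq
    · have hD' : D = 4 * (-(2 * m)) := by rw [hD, hm, h]; ring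
      have hq4 : D / 4 = -(2 * m) := by rw [hD']; exact Int.mul_ediv_cancel_left _ (by norm_num)
      refine ⟨⟨-(2 * m), hD'⟩, ?_, ?_⟩
      · rw [hq4]; left; omega
      · rw [hq4]; exact hsq_neg _ h2msq
  obtain ⟨K'', iF'', iN'', h2'', hdisc''⟩ :=
    Quadratic.exists_numberField_discr_eq (D := D) (Or.inr hDfund)
  have hK'' : IsImaginaryQuadratic K'' := isImaginaryQuadratic_of_discr_eq_of_neg h2'' hdisc'' hDneg
  -- §i `A ≅ Wd^{(d'')}`: `d_K · D = e₂² · u`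
  have hAWd : ∃ C : VariableChange ℚ, C • Wd.quadraticTwist (NumberField.discr K'' : ℚ) = A := by
    obtain ⟨C₁, hC₁⟩ := hAW
    obtain ⟨C₄, hC₄⟩ : ∃ C₄ : VariableChange ℚ, C₄ = ⟨Cd.u, ((D : ℤ) : ℚ) * Cd.r, 0, 0⟩ := ⟨_, rfl⟩
    have hparam : ((dK : ℤ) : ℚ) * ((D : ℤ) : ℚ) = ((u : ℤ) : ℚ) * ((e₂ : ℤ) : ℚ) ^ 2 := by
      have hdKfac : dK = e₂ * δ := hfac
      rw [hdKfac, hD, hu, hT]; push_cast; ring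
    have e1 : Wd.quadraticTwist ((D : ℤ) : ℚ) =
        C₄ • W.quadraticTwist (((u : ℤ) : ℚ) * ((e₂ : ℤ) : ℚ) ^ 2) := by
      rw [← hWd, WeierstrassCurve.quadraticTwist_smul, quadraticTwist_quadraticTwist, ← hC₄, hparam]
    have he₂0 : ((e₂ : ℤ) : ℚ) ≠ 0 := by exact_mod_cast he₂0'
    obtain ⟨C₂, hC₂⟩ := W.exists_variableChange_quadraticTwist_mul_sq (((u : ℤ) : ℚ)) _ he₂0
    have hWu : W.quadraticTwist ((u : ℤ) : ℚ) = C₁⁻¹ • A := by rw [← hC₁, inv_smul_smul]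
    have e2 : Wd.quadraticTwist ((D : ℤ) : ℚ) = (C₄ * C₂ * C₁⁻¹) • A := by
      rw [e1, ← hC₂, hWu, smul_smul, smul_smul]
    refine ⟨(C₄ * C₂ * C₁⁻¹)⁻¹, ?_⟩
    rw [hdisc'', e2, inv_smul_smul]
  -- §j good ordinary at `p`, surjective at `p`
  have hTd_sq : Squarefree (T * d) := by
    rw [squarefree_mul_iff]
    refine ⟨?_, ?_, hdsq⟩
    · refine (Int.isCoprime_iff_gcd_eq_one.mpr ?_).isRelPrime
      rw [Int.gcd_eq_natAbs]
      refine Nat.coprime_of_dvd fun ℓ hℓ hℓT hℓd ↦ hd_ndvd ℓ hℓ ?_ (Int.natAbs_dvd_natAbs.mp (by simpa using hℓd))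
      have hℓT' : (ℓ : ℤ) ∣ T := Int.natAbs_dvd_natAbs.mp (by simpa using hℓT)
      rw [hT] at hℓT'
      rcases Int.Prime.dvd_mul' hℓ hℓT' with h | h
      · -- `ℓ ∣ δ ∣ d_K`
        have hℓdK : ℓ ∣ dK.natAbs := by
          have := h.trans (⟨e₂, by rw [mul_comm]; exact hfac⟩ : δ ∣ dK)
          simpa using Int.natAbs_dvd_natAbs.mpr this
        exact hℓdK.mul_left _
      · have h' : ℓ ∣ ls.natAbs := by simpa using Int.natAbs_dvd_natAbs.mpr h
        rw [hls, natAbs_pStar] at h'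
        rw [(Nat.prime_dvd_prime_iff_eq hℓ hℓ₀).mp h']
        exact ⟨2 * p * M * dK.natAbs, by ring⟩
    · rw [hT, squarefree_mul_iff]
      refine ⟨?_, hδsq, ?_⟩
      · refine (Int.isCoprime_iff_gcd_eq_one.mpr ?_).isRelPrime
        rw [Int.gcd_eq_natAbs, hls, natAbs_pStar]
        exact Nat.Coprime.symm ((Nat.Prime.coprime_iff_not_dvd hℓ₀).mpr fun h ↦
          hℓ₀δ (Int.natAbs_dvd_natAbs.mp (by simpa using h)))
      · rw [hls]; exact (haveI := Fact.mk hℓ₀; squarefree_pStar (p := ℓ₀))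
  have hpTd : ¬ (p : ℤ) ∣ T * d := by
    intro h
    rcases Int.Prime.dvd_mul' hp.out h with h | h
    · rw [hT] at h
      rcases Int.Prime.dvd_mul' hp.out h with h | h
      · exact hpδ h
      · have h' : p ∣ ls.natAbs := by simpa using Int.natAbs_dvd_natAbs.mpr h
        rw [hls, natAbs_pStar] at h'
        exact hℓ₀p ((Nat.prime_dvd_prime_iff_eq hp.out hℓ₀).mp h').symm
    · exact hpd h
  have hgoA : GoodOrd A p := by
    obtain ⟨C₁, hC₁⟩ := hAV
    have hord : IsOrdinaryAt A p :=
      isOrdinaryAt_of_smul_eq_quadraticTwist V A hTd_sq hC₁ p hp2 hpTd ⟨hordV.1, hordV.2⟩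
    exact ⟨hord.1, hord.2⟩
  have hu0 : u ≠ 0 := by rw [hu]; exact mul_ne_zero (mul_ne_zero hps0' hT0) hd0
  have huq : ((u : ℤ) : ℚ) ≠ 0 := by exact_mod_cast hu0
  have hsurjA : Surj A p := (Additive.surj_iff_of_model_twist W p huq hAW).mpr hsurj
  -- §k arithmetic of `u = p* T d`
  have hu4 : u % 4 = 1 := by
    rw [hu, Int.mul_emod, show (ps * T) % 4 = 1 by rw [Int.mul_emod, hps4, hT4]; decide, hd4]; decide
  have husq : Squarefree u := by
    rw [hu, mul_assoc, squarefree_mul_iff]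
    refine ⟨?_, squarefree_pStar, hTd_sq⟩
    refine (Int.isCoprime_iff_gcd_eq_one.mpr ?_).isRelPrime
    rw [Int.gcd_eq_natAbs, hps, natAbs_pStar]
    exact (Nat.Prime.coprime_iff_not_dvd hp.out).mpr fun h ↦
      hpTd (Int.natAbs_dvd_natAbs.mp (by simpa using h))
  have hJu : ∀ ℓ : ℕ, ℓ.Prime → ℓ ∣ W.conductorNorm ℤ → ℓ ≠ p →
      (ℓ = 2 → u % 8 = 1) ∧ (ℓ ≠ 2 → J(u | ℓ) = 1) := by
    intro ℓ hℓ hℓW hℓp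
    have hℓV : ℓ ∣ V.conductorNorm ℤ := by
      rw [hNWV] at hℓW
      rcases (Nat.Prime.dvd_mul hℓ).mp hℓW with h | h
      · exact h
      · exact (hℓp ((Nat.prime_dvd_prime_iff_eq hℓ hp.out).mp (hℓ.dvd_of_dvd_pow h))).elim
    refine ⟨fun h2 ↦ ?_, fun h2 ↦ ?_⟩
    · subst h2
      rw [hu, Int.mul_emod, h8, hd8]; decide
    · rw [hu, jacobiSym.mul_left, hb ℓ hℓ hℓV h2,
        hdJ ℓ hℓ ((hℓW.mul_right (Wd.conductorNorm ℤ)).trans ⟨2 * p * ℓ₀ * dK.natAbs, by rw [hM]; ring⟩) h2]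
      norm_num
  -- §l splitting and ramification in `K''`
  have hsplit'' : ∀ ℓ : ℕ, ℓ.Prime → ℓ ∣ M → ℓ ≠ p → ℓ ≠ 2 → SatisfiesHeegnerHypothesis ℓ K'' := by
    intro ℓ hℓ hℓM hℓp hℓ2
    refine (satisfiesHeegnerHypothesis_iff_kronecker ℓ K'' h2'').mpr fun r hr hrℓ ↦ ?_
    obtain rfl : r = ℓ := (Nat.prime_dvd_prime_iff_eq hr hℓ).mp hrℓ
    rw [hdisc'']
    refine ⟨fun h2 ↦ (hℓ2 h2).elim, fun h2 ↦ ?_⟩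
    have hJls : J(ls | r) = J(ps * e₂ | r) := hJsplit r hr hℓM h2 hℓp
    have hJd : J(d | r) = 1 := hdJ r hr (hℓM.trans ⟨2 * p * ℓ₀ * dK.natAbs, by ring⟩) h2
    have hne₂ : ¬ (r : ℤ) ∣ ps * e₂ := by
      intro hd
      rcases Int.Prime.dvd_mul' hr hd with hd | hd
      · exact hℓp (eq_of_prime_dvd_pStar (p := p) hr hd)
      · have h8 : (r : ℤ) ∣ 8 := hd.trans he₂8
        have h8' : r ∣ 2 ^ 3 := by exact_mod_cast h8
        exact h2 ((Nat.prime_dvd_prime_iff_eq hr Nat.prime_two).mp (hr.dvd_of_dvd_pow h8'))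
    rw [hD, jacobiSym.mul_left, jacobiSym.mul_left, hJls, hJd, mul_one]
    exact jacobiSym_mul_self_eq_one hr hne₂
  have hram'' : ∀ ℓ : ℕ, ℓ.Prime → (ℓ : ℤ) ∣ NumberField.discr K'' → ℓ ∣ M → ℓ = p ∨ ℓ = 2 := by
    intro ℓ hℓ hℓD hℓM
    rw [hdisc'', hD] at hℓD
    rcases Int.Prime.dvd_mul' hℓ hℓD with h | h
    · rcases Int.Prime.dvd_mul' hℓ h with h | h
      · rcases Int.Prime.dvd_mul' hℓ h with h | h
        · exact Or.inl (eq_of_prime_dvd_pStar (p := p) hℓ h)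
        · have h8 : (ℓ : ℤ) ∣ 8 := h.trans he₂8
          have h8' : ℓ ∣ 2 ^ 3 := by exact_mod_cast h8
          exact Or.inr ((Nat.prime_dvd_prime_iff_eq hℓ Nat.prime_two).mp (hℓ.dvd_of_dvd_pow h8'))
      · exact (hℓ₀M ((haveI := Fact.mk hℓ₀; eq_of_prime_dvd_pStar (p := ℓ₀) hℓ h) ▸ hℓM)).elim
    · exact (hd_ndvd ℓ hℓ (hℓM.trans ⟨2 * p * ℓ₀ * dK.natAbs, by ring⟩) h).elim
  refine ⟨ℓ₀, e₂, T, d, K'', iF'', iN'', A, iA, iAm, hℓ₀, hℓ₀p, hℓ₀2, hℓ₀NWd, he₂, ?_, hK'', hsplit'', hram'',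
    hAWd, hAW, hu4, husq, hJu, hrA, hgoA, hsurjA⟩
  rw [hdisc'', hD]

end ClassTwo

end Summit.BirchSwinnertonDyer.BirchSwinnertonDyer.Theorems.WanAnyRoad

end
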